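import Mathlib
import Summits.NavierStokesRegularity.NavierStokesRegularity.Theorems.EulerZoomLiouvillePowerGaugeEulerLiouvilleSwirlfreeLedgerFlow
import Summits.NavierStokesRegularity.NavierStokesRegularity.Theorems.EulerZoomLiouvillePowerGaugeEulerLiouvilleSwirlfreeLedgerConfinement
import Literature.Analysis.FluidPDE.AncientMildWeakStar
import Literature.Analysis.FluidPDE.ClassicalSolution
import Literature.Analysis.FluidPDE.AxisymmetricEuler
import HarnessLib

/-!
# Crux `EulerZoomLiouville.PowerGaugeEulerLiouville` (stmt-NavierStokesRegularity-19832), line `casimir-floor`, stub K1: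
# LEDGER BLOBS PERSIST BACKWARD (transport of the mass AND the supremum of `|curl u| / r`)

Route №10 `EulerZoomLiouville` (NavierStokesRegularity), crux E.  Line `casimir-floor` (ideator ns-idea-11 g3;
`Cruxes/PowerGaugeEulerLiouville/Lines/casimir_floor.lean`), registered stub `stub_blobTransport` (K1), proved here with its signature
UNFOLDED in the tree's vocabulary (the line's `IsSwirlFreeDriftingWith`, `LedgerBlobsPersist`, `driftRadius`,
`axisLedger v x = ‖curl v x‖ / cylRadius x` are `def`s of the Cruxes file; the statement below is their `δ`-unfolding, so the skeleton
fills the stub by `theorem stub_blobTransport : Sig.stub_blobTransport := ledgerBlobsPersist_of_swirlFreeDriftingWith`).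

THE STATEMENT.  Let `(u, p)` be a classical Euler solution on `(−∞,0) × ℝ³` with axisymmetric swirl-free slices and drift data
`(M, κ)`: `0 ≤ M`, `κ < 1`, `‖u(τ, x)‖ ≤ M (−τ)^{−κ}` for `τ < 0`.  Let `t₁ < t₀ < 0`, and let `B(x₀, δ)` be a late off-axis ball
(`0 < δ < r(x₀)`) on which the ledger density `η(t₀) = |curl u(t₀)| / r` is `≤ W`.  Then there is a measurable
`T ⊆ B(0, ‖x₀‖ + δ + D)`, `D = M((−t₁)^{1−κ} − (−t₀)^{1−κ})/(1−κ)` (the line's `driftRadius M κ t₀ t₁`), on which `η(t₁) ≤ W` and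
`∫_{B(x₀,δ)} η(t₀) ≤ ∫_T η(t₁)`.

THE PROOF is the Lagrangian one of the sibling line `swirlfree-ledger` (its S2, `…SwirlfreeLedgerFlow` / `…SwirlfreeLedgerConfinement`,
there for centred balls, full parabolic windows and the `q`-ledger), re-cut to an arbitrary late off-axis ball, a partial window and
the density itself: `T = φ(t₁, t₀, B(x₀, δ))` for the flow `φ` of the cut-off field `w = χ u` (`χ = 1` on `B̄(0, ‖x₀‖ + δ + D + 1)`),
which on the parcels of the ball IS the Euler flow — (i) CONFINEMENT `‖φ(s,t₀,x) − x‖ ≤ M((−s)^{1−κ} − (−t₀)^{1−κ})/(1−κ) ≤ D` on `[t₁,t₀]`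
(`norm_evolutionMap_sub_le`, any `κ < 1`); (ii) the parcels are off the axis (`δ < r(x₀)`) and stay off it
(`cylRadius_evolutionMap_ne_zero`), and `θ = ω_θ/r` is conserved along them (`omegaTilde_evolutionMap_eq`), `|curl u|/r = |θ|` off the
axis (`div_cylRadius_eq_abs_omegaTilde`): the density is transported POINTWISE, so `η(t₁) ≤ W` on `T` and the integrands agree;
(iii) `det Dφ = 1` (`det_fderiv_evolutionMap_eq_one_of_divergence`) and the change of variables `lintegral_comp_evolutionMap_le` give
the mass inequality; (iv) `T` is measurable by Lusin–Souslin (continuous injective image of a ball).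

* **`ledgerBlobsPersist_of_swirlFreeDriftingWith`** — the stub signature, unfolded.

WHAT THIS IS NOT: not NS, not the crux — a helper `--supports` stmt-19832 on the line `casimir-floor` (a stratum statement about a
hypothetical Euler zoom-limit class); no summit statement is proved here and nothing here bears on NS regularity itself.
[cite: MajdaBertozziCUP2002, §2.3.3 (2.58)–(2.59), §1.3 Prop. 1.4, §4.2 (4.48)]
-/

noncomputable section

-- flat `Theorems/<Route><Decl>…` files of one crux share the namespace of the crux (tree convention)
set_option linter.dupNamespace false

open MeasureTheory Set Filter Topology Metric Function
open scoped NNReal ENNReal ContDiff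

namespace Summit.NavierStokesRegularity.NavierStokesRegularity.Theorems.PowerGaugeEulerLiouville.CasimirFloor

open Literature.Analysis Literature.Analysis.FluidPDE
open Summit.NavierStokesRegularity.NavierStokesRegularity.Theorems.PowerGaugeEulerLiouville.SwirlfreeLedger

/-- **K1 `stub_blobTransport` of the line `casimir-floor`, signature unfolded** (`IsSwirlFreeDriftingWith u p M κ → LedgerBlobsPersist u M κ`
with the line's abbreviations `IsSwirlFreeDriftingWith`, `LedgerBlobsPersist`, `driftRadius`, `axisLedger` `δ`-unfolded): on the classical
axisymmetric swirl-free stratum with drift data `(M, κ)`, `κ < 1`, every late off-axis blob `B(x₀, δ)` (`δ < r(x₀)`) at time `t₀ < 0`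
with ledger density `≤ W` has at each earlier time `t₁` a measurable avatar `T ⊆ B(0, ‖x₀‖ + δ + driftRadius)` with density `≤ W` and at
least the same ledger mass (`T` = backward flow image; proof in the module docstring).
[cite: MajdaBertozziCUP2002, §2.3.3 (2.58)–(2.59), §1.3 Prop. 1.4] -/
theorem ledgerBlobsPersist_of_swirlFreeDriftingWith :
    ∀ (u : ℝ → EuclideanSpace ℝ (Fin 3) → EuclideanSpace ℝ (Fin 3)) (p : ℝ → EuclideanSpace ℝ (Fin 3) → ℝ) (M κ : ℝ),
      (IsClassicalEulerSolutionOn (Set.Iio 0) 0 u p ∧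
          (∀ τ : ℝ, τ < 0 → IsAxisymmetric (u τ) ∧ HasNoSwirl (u τ)) ∧
          0 ≤ M ∧ κ < 1 ∧ ∀ τ : ℝ, τ < 0 → ∀ x : EuclideanSpace ℝ (Fin 3), ‖u τ x‖ ≤ M * (-τ) ^ (-κ)) →
      ∀ t₀ : ℝ, t₀ < 0 → ∀ (x₀ : EuclideanSpace ℝ (Fin 3)) (δ W : ℝ), 0 < δ → δ < cylRadius x₀ →
        (∀ x ∈ ball x₀ δ, ‖curl (u t₀) x‖ / cylRadius x ≤ W) →
        ∀ t₁ : ℝ, t₁ < t₀ →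
          ∃ T : Set (EuclideanSpace ℝ (Fin 3)), MeasurableSet T ∧
            T ⊆ ball (0 : EuclideanSpace ℝ (Fin 3)) (‖x₀‖ + δ + M / (1 - κ) * ((-t₁) ^ (1 - κ) - (-t₀) ^ (1 - κ))) ∧
            (∀ x ∈ T, ‖curl (u t₁) x‖ / cylRadius x ≤ W) ∧
            ∫⁻ x in ball x₀ δ, ENNReal.ofReal (‖curl (u t₀) x‖ / cylRadius x) ≤
              ∫⁻ x in T, ENNReal.ofReal (‖curl (u t₁) x‖ / cylRadius x) := by
  intro u p M κ hstr t₀ ht₀ x₀ δ W hδ hδr hηW t₁ ht₁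
  obtain ⟨hcl, hsym, hM0, hκ1, hM⟩ := hstr
  -- the drift radius `D ≥ 0` and the confinement radius `Rc`
  set D : ℝ := M / (1 - κ) * ((-t₁) ^ (1 - κ) - (-t₀) ^ (1 - κ)) with hD
  have h1κ : 0 < 1 - κ := by linarith
  have hK0 : 0 ≤ M / (1 - κ) := div_nonneg hM0 h1κ.le
  have hmono : ∀ s ∈ Icc t₁ t₀, M / (1 - κ) * ((-s) ^ (1 - κ) - (-t₀) ^ (1 - κ)) ≤ D := by
    intro s hs
    rw [hD]
    refine mul_le_mul_of_nonneg_left ?_ hK0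
    have h : (-s) ^ (1 - κ) ≤ (-t₁) ^ (1 - κ) :=
      Real.rpow_le_rpow (by linarith [hs.2]) (by linarith [hs.1]) h1κ.le
    linarith
  have hD0 : 0 ≤ D := by
    have h := hmono t₀ (right_mem_Icc.2 ht₁.le)
    rwa [sub_self, mul_zero] at h
  set Rc : ℝ := ‖x₀‖ + δ + D with hRc
  have hRc0 : 0 < Rc := by positivity
  -- the times
  set S : Set ℝ := Set.Ioo (t₁ - 1) (t₀ / 2) with hS
  have hSo : IsOpen S := isOpen_Ioo
  have hSc : Convex ℝ S := convex_Ioo _ _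
  have ht₀S : t₀ ∈ S := ⟨by linarith, by linarith⟩
  have ht₁S : t₁ ∈ S := ⟨by linarith, by linarith⟩
  have hSneg : S ⊆ Set.Iio 0 := fun s hs => lt_trans hs.2 (by linarith)
  have hclS : IsClassicalEulerSolutionOn S 0 u p := hcl.mono hSneg hSo.uniqueDiffOn
  have hsymS : ∀ s ∈ S, IsAxisymmetric (u s) := fun s hs => (hsym s (hSneg hs)).1
  have hswS : ∀ s ∈ S, HasNoSwirl (u s) := fun s hs => (hsym s (hSneg hs)).2
  -- the cut-off flow
  set χ : ContDiffBump (0 : EuclideanSpace ℝ (Fin 3)) := ⟨Rc + 1, Rc + 2, by linarith, by linarith⟩ with hχ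
  have hrIn : χ.rIn = Rc + 1 := rfl
  have hwsmooth : IsSmoothSpaceTimeOn S (fun t z => χ z • u t z) := isSmoothSpaceTimeOn_bump_smul χ hclS.smooth_velocity
  have hL : ODE.IsUniformlyLipschitzOn (fun t z => χ z • u t z) S := isUniformlyLipschitzOn_bump_smul χ hSo hclS.smooth_velocity
  have hspeed : ∀ s ∈ Icc t₁ t₀, ∀ y, ‖(fun t z => χ z • u t z) s y‖ ≤ M * (-s) ^ (-κ) := fun s hs y =>
    (norm_bump_smul_le χ (u s) y).trans (hM s (by linarith [hs.2]) y)
  -- confinement of the parcels of `B(x₀, δ)`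
  have hconf : ∀ x ∈ ball x₀ δ, ∀ s ∈ Icc t₁ t₀, ‖ODE.evolutionMap (fun t z => χ z • u t z) t₀ s x‖ < Rc := by
    intro x hx s hs
    have hd := norm_evolutionMap_sub_le hL hSc hSo ht₁S ht₀S ht₀ hκ1 hspeed x hs
    have hxn : ‖x‖ < ‖x₀‖ + δ := by
      have h1 : ‖x - x₀‖ < δ := mem_ball_iff_norm.1 hx
      linarith [norm_le_norm_add_norm_sub' x x₀]
    calc ‖ODE.evolutionMap (fun t z => χ z • u t z) t₀ s x‖
        ≤ ‖x‖ + ‖ODE.evolutionMap (fun t z => χ z • u t z) t₀ s x - x‖ := norm_le_norm_add_norm_sub' _ _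
      _ < ‖x₀‖ + δ + D := add_lt_add_of_lt_of_le hxn (hd.trans (hmono s hs))
  have hconf_in : ∀ x ∈ ball x₀ δ, ∀ s ∈ Icc t₁ t₀,
      ODE.evolutionMap (fun t z => χ z • u t z) t₀ s x ∈ ball (0 : EuclideanSpace ℝ (Fin 3)) χ.rIn := by
    intro x hx s hs
    rw [mem_ball_zero_iff, hrIn]
    linarith [hconf x hx s hs]
  -- the axis
  have haxisw : ∀ s ∈ S, ∀ z : EuclideanSpace ℝ (Fin 3), z 0 = 0 → z 1 = 0 →
      (fun t z => χ z • u t z) s z 0 = 0 ∧ (fun t z => χ z • u t z) s z 1 = 0 := by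
    intro s hs z hz0 hz1
    have h := Wei2016.apply_zero_one_eq_zero_of_axis (hsymS s hs) hz0 hz1
    simp [h.1, h.2]
  -- the blob is off the axis
  have hoff : ∀ x ∈ ball x₀ δ, cylRadius x ≠ 0 := by
    intro x hx h0
    have h1 := cylRadius_le_cylRadius_add_norm_sub x x₀
    have h2 : ‖x₀ - x‖ < δ := by rw [← dist_eq_norm, dist_comm]; exact hx
    rw [h0, zero_add] at h1
    linarith
  -- incompressibility along confined trajectories
  have hdet : ∀ x ∈ ball x₀ δ, (fderiv ℝ (ODE.evolutionMap (fun t z => χ z • u t z) t₀ t₁) x).det = 1 := by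
    intro x hx
    refine det_fderiv_evolutionMap_eq_one_of_divergence hL hwsmooth hSc hSo.uniqueDiffOn ht₀S ht₁S x fun s hs => ?_
    rw [uIcc_of_ge ht₁.le] at hs
    have hsS : s ∈ S := hSc.ordConnected.out ht₁S ht₀S hs
    have hball := hconf_in x hx s hs
    have h0 := hclS.divFree s hsS (ODE.evolutionMap (fun t z => χ z • u t z) t₀ s x)
    unfold VectorCalculus.divergence at h0 ⊢
    rwa [fderiv_bump_smul_eq χ (u s) hball]
  -- the density is transported pointwise along the parcels of the blob
  have hC2 : ∀ τ : ℝ, τ < 0 → ContDiff ℝ 2 (u τ) := fun τ hτ => (hcl.contDiff_velocity hτ).of_le (by norm_cast)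
  have ht₁0 : t₁ < 0 := lt_trans ht₁ ht₀
  have htrans : ∀ x ∈ ball x₀ δ,
      ‖curl (u t₁) (ODE.evolutionMap (fun t z => χ z • u t z) t₀ t₁ x)‖ /
          cylRadius (ODE.evolutionMap (fun t z => χ z • u t z) t₀ t₁ x) = ‖curl (u t₀) x‖ / cylRadius x := by
    intro x hx
    have hxoff := hoff x hx
    have hΦoff : cylRadius (ODE.evolutionMap (fun t z => χ z • u t z) t₀ t₁ x) ≠ 0 :=
      cylRadius_evolutionMap_ne_zero hL hSc haxisw ht₀S ht₁S hxoff
    have htr := omegaTilde_evolutionMap_eq hclS hSo hSc hsymS hswS χ ht₁S ht₀S ht₁.le hxoff (hconf_in x hx)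
    have e0 := div_cylRadius_eq_abs_omegaTilde (hsym t₀ ht₀).1 (hsym t₀ ht₀).2 (hC2 t₀ ht₀) hxoff
    have e1 := div_cylRadius_eq_abs_omegaTilde (hsym t₁ ht₁0).1 (hsym t₁ ht₁0).2 (hC2 t₁ ht₁0) hΦoff
    rw [e0, e1]
    simp only [vorticity_apply] at htr
    rw [htr]
  -- the avatar `T = φ(t₁, t₀, B(x₀, δ))`
  have hcont : Continuous (ODE.evolutionMap (fun t z => χ z • u t z) t₀ t₁) :=
    (hL.contDiff_evolutionMap hSc hSo.uniqueDiffOn le_top hwsmooth ht₀S ht₁S).continuous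
  have hinj : InjOn (ODE.evolutionMap (fun t z => χ z • u t z) t₀ t₁) (ball x₀ δ) :=
    (hL.bijective_evolutionMap hSc ht₀S ht₁S).injective.injOn
  refine ⟨ODE.evolutionMap (fun t z => χ z • u t z) t₀ t₁ '' ball x₀ δ,
    measurableSet_ball.image_of_continuousOn_injOn hcont.continuousOn hinj, ?_, ?_, ?_⟩
  · rintro _ ⟨x, hx, rfl⟩
    exact mem_ball_zero_iff.2 (hconf x hx t₁ (left_mem_Icc.2 ht₁.le))
  · rintro _ ⟨x, hx, rfl⟩
    rw [htrans x hx]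
    exact hηW x hx
  · calc ∫⁻ x in ball x₀ δ, ENNReal.ofReal (‖curl (u t₀) x‖ / cylRadius x)
        = ∫⁻ x in ball x₀ δ, ENNReal.ofReal (‖curl (u t₁) (ODE.evolutionMap (fun t z => χ z • u t z) t₀ t₁ x)‖ /
            cylRadius (ODE.evolutionMap (fun t z => χ z • u t z) t₀ t₁ x)) :=
          setLIntegral_congr_fun measurableSet_ball fun x hx => by rw [htrans x hx]
      _ ≤ ∫⁻ y in ODE.evolutionMap (fun t z => χ z • u t z) t₀ t₁ '' ball x₀ δ,
            ENNReal.ofReal (‖curl (u t₁) y‖ / cylRadius y) :=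
          lintegral_comp_evolutionMap_le hL hwsmooth hSc hSo.uniqueDiffOn ht₀S ht₁S measurableSet_ball hdet
            (mapsTo_image _ _) fun y => ENNReal.ofReal (‖curl (u t₁) y‖ / cylRadius y)

end Summit.NavierStokesRegularity.NavierStokesRegularity.Theorems.PowerGaugeEulerLiouville.CasimirFloor

end
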